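import Literature.Probability.Percolation.LocalLimitMeasure
import Literature.Probability.Percolation.BondPercolationSymmetry
import Literature.Probability.LatticeModels.RandomClusterDomainMarkov
import Literature.Barriers.CriticalPhenomena.RandomClusterFirstOrder
import HarnessLib

/-!
# Infinite-volume random-cluster measures on `ℤ^d`: the limit measures `φ⁰_{p,q}`, `φ¹_{p,q}` as a property of a
# measure (Grimmett 2006, Thm. (4.19)), and the hypothesis structure `IsFKGibbs` (translation invariance, positive
# association, free/wired boundary-condition sandwich, ergodicity)

Topic `Literature/Probability/LatticeModels`.  The tree has the finite-volume random-cluster measures `rcMeasure`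
(Grimmett 2006 (1.2), wired vertex sets §4.2), their domain Markov / comparison / FKG theory
(`RandomClusterDomainMarkov*`, `RandomClusterConditionalDomination`, `RandomClusterFKG`), the box functionals
`thetaWired`/`thetaFree`, the generic local-limit packaging of Kolmogorov's theorem
(`Literature.Probability.Percolation.LocalLimitMeasure`), and — on `ℤ²` only, for free boundary conditions and cylinder
events — the infinite-volume measure as a property of a measure (`IsFreeRandomClusterLimit`,
`FKLoopNestingGaussianLimit.lean`, with existence/uniqueness/FKG/invariance in `FKLoopNestingMeasure*.lean`).  This file
sets up the general-`d`, two-boundary-condition vocabulary used by the FK-continuity programme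
(`Summits/CriticalPhenomena/PercolationContinuityZ3`, cell fk-continuity, FANOUT-PLAN FO-06); it contains DEFINITIONS and
soft lemmas only (no `sorry`, no named fact).  The analytic content — existence of the limits (Thm. (4.19)(a)) and the
proof that they satisfy `IsFKGibbs` (Thm. (4.17)(b)(c), (4.19)(b)(d), Lemma (4.13)/(4.14)(b), Cor. (4.23)) — is proved in
companion files.

## What is here

* `RCBoundary` — the two extremal boundary conditions `b ∈ {0, 1}` = `free | wired` (Grimmett 2006, §4.2 p. 72), and
  `RCBoundary.wiredSet b Λ` — the vertex set of the finite region `Λ` wired by `b` (`∅`, resp. the inner vertex boundary `∂Λ`,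
  the tree's `wiredBoundary`).
* `toLattice Λ : BondConfig ↥Λ → BondConfig (Site d)` — a configuration of the finite piece `(Λ, E_Λ)` read as a
  configuration of `ℤ^d` (pairs off `Λ` closed): `ω ↦ Sym2.map Subtype.val '' ω` (the map used, unnamed, by the `d = 2`
  files `Literature.Probability.Percolation.FKLoopNesting*`).
* `rcLaw d p q Λ W` — the random-cluster measure `φ^W_{Λ,p,q}` of the finite region `Λ ⊆ ℤ^d` with wired vertex set `W`
  (`rcMeasure (finsetGraph (zdGraph d) Λ) p q W`, Grimmett 2006 (4.11)–(4.12)), pushed forward to `ℤ^d` by `toLattice`;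
  `rcBoxLaw d b p q n = φ^b_{Λ_n,p,q}` for the box `Λ_n = [-n,n]^d` (`box d n`).  For `b = wired` the underlying finite
  measure is *definitionally* the one of the tree's `thetaWiredBox` / `boxWiredReal`
  (`rcMeasure (boxGraph d n) p q (boxBoundary d n)`), for `b = free` the one of `boxFreeReal` / `thetaFreeBox`
  (`rcBoxLaw_wired_eq_map`, `rcBoxLaw_free_eq_map`).
* `IsRandomClusterLimit d b p q P` — **`P` is the limit random-cluster measure `φ^b_{p,q}` on `ℤ^d`** (Grimmett 2006,
  Thm. (4.19)(a), eq. (4.20), along `Λ_n = [-n,n]^d`): `P` is a probability measure on `BondConfig (Site d)` and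
  `φ^b_{Λ_n,p,q}(A) → P(A)` for every LOCAL event `A` (generalises `IsFreeRandomClusterLimit` from `Site 2`, cylinder
  events, `b = 0` to `Site d`, local events, `b ∈ {0,1}`).  Such a `P` is unique (`IsRandomClusterLimit.unique`, local
  events generate) and is carried by lattice configurations (`IsRandomClusterLimit.ae_subset_edgeSet`).  EXISTENCE for
  `p ∈ [0,1]`, `q ≥ 1` (Thm. (4.19)(a)) is a companion file, not assumed here.
* `IsFKGibbs d p q P` — **hypothesis structure: an infinite-volume random-cluster measure with parameters `p, q` in the
  sandwich (weak DLR) sense** — the properties of `φ^b_{p,q}` that Kozma–Nitzan-type arguments consume, bundled as in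
  the tree's `IsInsertionTolerantErgodic`: a probability measure on bond configurations of `ℤ^d`, carried by the
  lattice, translation invariant (Thm. (4.19)(b)), positively associated on increasing local events (Thm. (4.17)(c)),
  ergodic under every non-zero translation (Cor. (4.23)), and satisfying the **boundary-condition sandwich form of the
  domain Markov property** (Lemma (4.13) with Lemma (4.14)(b)): for every finite region `Λ`, every increasing event `A`
  determined by the edges `E_Λ`, and every event `H` determined by finitely many pairs off `E_Λ`,
  `φ⁰_{Λ,p,q}(A) · P(H) ≤ P(A ∩ H) ≤ φ¹_{Λ,p,q}(A) · P(H)`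
  — the conditional law in `Λ` given local information outside lies stochastically between the free and the wired
  measure of `Λ`.  The DLR equation proper (Def. (4.29)–(4.30)), true for `φ^b_{p,q}` by Thm. (4.34)(b) but resting on
  Burton–Keane uniqueness and almost-sure quasilocality (Thm. (4.31), Lemma (4.39)), is deliberately NOT a field; finite
  energy (Thm. (3.1) eq. (3.3), Thm. (4.17)(b): `p/(p+q(1-p)) ≤ P(e open | 𝒯_e) ≤ p`) is the sandwich for the one-edge
  region and is derived, not posited (companion file).  Derived here: the `IsInsertionTolerantErgodic`-shaped
  consequences `IsFKGibbs.measure_preimage_shift`, `IsFKGibbs.zero_one` (for the generic Burton–Keane theorem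
  `Literature.Probability.Percolation.ae_numInfiniteClusters_le_one_of_isInsertionTolerantErgodic`), and the
  unconditioned comparisons `IsFKGibbs.rcLaw_free_le`, `IsFKGibbs.le_rcLaw_wired` (Thm. (4.19)(c), (4.21)).

That `φ^b_{p,q}` (`b = 0,1`, `p ∈ [0,1]`, `q ≥ 1`) satisfy `IsFKGibbs` is a theorem of the companion files; any consumer
taking `(h : IsFKGibbs d p q P)` as a hypothesis is conditional on it until then and says so.

## References

* G. Grimmett, *The Random-Cluster Model*, Springer 2006: §4.2 (4.11)–(4.12), Lemma (4.13), Lemma (4.14); §4.3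
  Thm. (4.17), Thm. (4.19), (4.20), (4.21), Cor. (4.23); §4.4 Def. (4.29)–(4.30), Thm. (4.31), (4.33), (4.34),
  Prop. (4.37), Lemma (4.39). [Grimmett2006]
* G. Grimmett, *Percolation*, 2nd ed., Springer 1999, §2.2 (local events). [GrimmettPercolation1999]
-/

noncomputable section

open MeasureTheory Filter Topology Set
open scoped ENNReal

namespace Literature.Probability.LatticeModels

open Literature.Probability.Percolation Literature.Barriers.CriticalPhenomena

variable {d : ℕ}

/-! ### Boundary conditions and finite regions of `ℤ^d` -/

/-- The two extremal boundary conditions of the random-cluster model on a finite region: `free` (`b = 0`, all edges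
off the region closed) and `wired` (`b = 1`, all edges off the region open, i.e. the boundary of the region wired into one
cluster). [cite: Grimmett2006, §4.2 (p. 72, free and wired boundary conditions)] -/
inductive RCBoundary : Type
  /-- free boundary condition, `b = 0` -/
  | free : RCBoundary
  /-- wired boundary condition, `b = 1` -/
  | wired : RCBoundary
  deriving DecidableEq

/-- The vertex set of the finite region `Λ ⊆ ℤ^d` wired by the boundary condition `b`: nothing for `free`, the inner
vertex boundary `∂Λ` (the tree's `wiredBoundary (zdGraph d) Λ`) for `wired`. [cite: Grimmett2006, §4.2 (4.11)–(4.12), ξ = 0, 1] -/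
def RCBoundary.wiredSet : RCBoundary → (Λ : Finset (Site d)) → Set ↥Λ
  | .free, _ => ∅
  | .wired, Λ => wiredBoundary (zdGraph d) Λ

/-- `free` wires nothing. [cite: Grimmett2006, §4.2] -/
@[simp] theorem RCBoundary.wiredSet_free (Λ : Finset (Site d)) : RCBoundary.free.wiredSet Λ = ∅ := rfl

/-- `wired` wires the inner vertex boundary. [cite: Grimmett2006, §4.2] -/
@[simp] theorem RCBoundary.wiredSet_wired (Λ : Finset (Site d)) : RCBoundary.wired.wiredSet Λ = wiredBoundary (zdGraph d) Λ := rfl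

/-- A bond configuration of the finite piece `(Λ, E_Λ)` of `ℤ^d` (vertex type `↥Λ`) read as a bond configuration of `ℤ^d`,
all pairs off `Λ` closed: `ω ↦ Sym2.map Subtype.val '' ω`. [cite: Grimmett2006, §4.2 (Ω^0_Λ: configurations vanishing off E_Λ)] -/
abbrev toLattice (Λ : Finset (Site d)) : BondConfig ↥Λ → BondConfig (Site d) :=
  Set.image (Sym2.map (Subtype.val : ↥Λ → Site d))

/-- Membership in the lattice reading of a piece configuration. [cite: Grimmett2006, §4.2 (configurations on E_Λ)] -/
theorem mem_toLattice_iff {Λ : Finset (Site d)} (ω : BondConfig ↥Λ) (e : Sym2 (Site d)) :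
    e ∈ toLattice Λ ω ↔ ∃ e' ∈ ω, Sym2.map Subtype.val e' = e := Iff.rfl

/-- `toLattice` is monotone (so pull-backs of increasing events are increasing). [cite: Grimmett2006, §4.2 (configurations on E_Λ)] -/
theorem toLattice_mono (Λ : Finset (Site d)) : Monotone (toLattice Λ) := fun _ _ h => Set.image_mono h

/-- `toLattice` is measurable (its domain is a finite measurable space with measurable singletons). [cite: Grimmett2006, §4.1–§4.2 (the σ-field 𝓕, configurations on E_Λ)] -/
theorem measurable_toLattice (Λ : Finset (Site d)) : Measurable (toLattice Λ) := measurable_of_finite _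

/-- Every pair of the lattice reading lies inside `Λ`. [cite: Grimmett2006, §4.2 (E_Λ)] -/
theorem forall_mem_of_mem_toLattice {Λ : Finset (Site d)} {ω : BondConfig ↥Λ} {e : Sym2 (Site d)}
    (he : e ∈ toLattice Λ ω) : ∀ x ∈ e, x ∈ Λ := by
  obtain ⟨e', -, rfl⟩ := he
  intro x hx
  obtain ⟨y, -, rfl⟩ := Sym2.mem_map.1 hx
  exact y.2

/-- The pull-back of an increasing event of `ℤ^d` along `toLattice` is increasing. [cite: Grimmett2006, §4.2 and §2.1 (increasing events)] -/
theorem IsUpperSet.preimage_toLattice {Λ : Finset (Site d)} {A : Set (BondConfig (Site d))} (hA : IsUpperSet A) :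
    IsUpperSet (toLattice Λ ⁻¹' A) :=
  hA.preimage (toLattice_mono Λ)

/-! ### Finite-volume random-cluster laws read on `ℤ^d` -/

section Laws

variable (d)

/-- `φ^W_{Λ,p,q}` read on `ℤ^d`: the random-cluster measure of the finite region `(Λ, E_Λ)` of `ℤ^d` with wired vertex set
`W` (the tree's `rcMeasure (finsetGraph (zdGraph d) Λ) p q W`, Grimmett 2006 (4.11)–(4.12) with the boundary condition that
wires `W` into one cluster), pushed forward along `toLattice`. [cite: Grimmett2006, §4.2 (4.11)–(4.12)] -/
def rcLaw (p q : ℝ) (Λ : Finset (Site d)) (W : Set ↥Λ) : Measure (BondConfig (Site d)) :=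
  (rcMeasure (finsetGraph (zdGraph d) Λ) p q W).map (toLattice Λ)

/-- `φ^b_{Λ_n,p,q}` read on `ℤ^d`: the free (`b = free`), resp. wired (`b = wired`), random-cluster measure of the box
`Λ_n = [-n,n]^d`. [cite: Grimmett2006, §4.2 (4.11)–(4.12) and Thm. (4.19)(a)] -/
def rcBoxLaw (b : RCBoundary) (p q : ℝ) (n : ℕ) : Measure (BondConfig (Site d)) :=
  rcLaw d p q (box d n) (b.wiredSet (box d n))

variable {d}

/-- The law read on `ℤ^d` evaluates an event by its pull-back. [cite: Grimmett2006, §4.2 (4.11)–(4.12)] -/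
theorem rcLaw_apply (p q : ℝ) (Λ : Finset (Site d)) (W : Set ↥Λ) {A : Set (BondConfig (Site d))}
    (hA : MeasurableSet A) :
    rcLaw d p q Λ W A = rcMeasure (finsetGraph (zdGraph d) Λ) p q W (toLattice Λ ⁻¹' A) := by
  rw [rcLaw, Measure.map_apply (measurable_toLattice Λ) hA]

/-- Real-valued form of `rcLaw_apply`. [cite: Grimmett2006, §4.2 (4.11)–(4.12)] -/
theorem rcLaw_real_apply (p q : ℝ) (Λ : Finset (Site d)) (W : Set ↥Λ) {A : Set (BondConfig (Site d))}
    (hA : MeasurableSet A) :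
    (rcLaw d p q Λ W).real A = (rcMeasure (finsetGraph (zdGraph d) Λ) p q W).real (toLattice Λ ⁻¹' A) := by
  simp only [measureReal_def, rcLaw_apply p q Λ W hA]

/-- `φ^W_{Λ,p,q}` read on `ℤ^d` is a probability measure for `0 ≤ p ≤ 1`, `0 < q`. [cite: Grimmett2006, §4.2 (4.12)] -/
theorem isProbabilityMeasure_rcLaw {p q : ℝ} (hp : p ∈ Set.Icc (0 : ℝ) 1) (hq : 0 < q) (Λ : Finset (Site d))
    (W : Set ↥Λ) : IsProbabilityMeasure (rcLaw d p q Λ W) := by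
  haveI := isProbabilityMeasure_rcMeasure (finsetGraph (zdGraph d) Λ) hp hq W
  exact Measure.isProbabilityMeasure_map (measurable_toLattice Λ).aemeasurable

/-- The box law evaluates an event by its pull-back to the box. [cite: Grimmett2006, §4.2 (4.11)–(4.12)] -/
theorem rcBoxLaw_real_apply (b : RCBoundary) (p q : ℝ) (n : ℕ) {A : Set (BondConfig (Site d))} (hA : MeasurableSet A) :
    (rcBoxLaw d b p q n).real A =
      (rcMeasure (finsetGraph (zdGraph d) (box d n)) p q (b.wiredSet (box d n))).real (toLattice (box d n) ⁻¹' A) :=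
  rcLaw_real_apply p q _ _ hA

/-- `φ^b_{Λ_n,p,q}` read on `ℤ^d` is a probability measure for `0 ≤ p ≤ 1`, `0 < q`. [cite: Grimmett2006, §4.2 (4.12)] -/
theorem isProbabilityMeasure_rcBoxLaw (b : RCBoundary) {p q : ℝ} (hp : p ∈ Set.Icc (0 : ℝ) 1) (hq : 0 < q) (n : ℕ) :
    IsProbabilityMeasure (rcBoxLaw d b p q n) :=
  isProbabilityMeasure_rcLaw hp hq _ _

/-- The WIRED box law is the push-forward of the measure `φ¹_{Λ_n,p,q} = rcMeasure (boxGraph d n) p q (boxBoundary d n)` of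
the tree's `thetaWiredBox` / `boxWiredReal` (definitionally the same finite measure). [cite: Grimmett2006, §4.2 (4.11)–(4.12), ξ = 1] -/
theorem rcBoxLaw_wired_eq_map (p q : ℝ) (n : ℕ) :
    rcBoxLaw d RCBoundary.wired p q n = (rcMeasure (boxGraph d n) p q (boxBoundary d n)).map (toLattice (box d n)) := rfl

/-- The FREE box law is the push-forward of `φ⁰_{Λ_n,p,q} = rcMeasure (finsetGraph (zdGraph d) (box d n)) p q ∅`, the
measure of the tree's `boxFreeReal` / `thetaFreeBox`. [cite: Grimmett2006, §4.2 (4.11)–(4.12), ξ = 0] -/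
theorem rcBoxLaw_free_eq_map (p q : ℝ) (n : ℕ) :
    rcBoxLaw d RCBoundary.free p q n = (rcMeasure (finsetGraph (zdGraph d) (box d n)) p q ∅).map (toLattice (box d n)) := rfl

end Laws

/-! ### The limit random-cluster measures `φ^b_{p,q}` as a property of a measure -/

/-- **`P` is the limit random-cluster measure `φ^b_{p,q}` on `ℤ^d`** (Grimmett 2006, Thm. (4.19)(a), eq. (4.20)): `P` is a
probability measure on the bond configurations of `ℤ^d` and, for every LOCAL event `A` (determined by finitely many
pairs), `φ^b_{Λ_n,p,q}(A) → P(A)` along the boxes `Λ_n = [-n,n]^d`, the box configurations being read on `ℤ^d` with the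
pairs off the box closed.  For `p ∈ [0,1]`, `q ≥ 1` such a `P` exists (Thm. (4.19)(a); the construction half of FO-06,
companion file) and it is unique (`IsRandomClusterLimit.unique`).  Generalises the tree's `IsFreeRandomClusterLimit`
(`ℤ²`, cylinder events, `b = 0`). [cite: Grimmett2006, Thm. (4.19)(a) and (4.20)] -/
structure IsRandomClusterLimit (d : ℕ) (b : RCBoundary) (p q : ℝ) (P : Measure (BondConfig (Site d))) : Prop where
  /-- `P` is a probability measure. -/
  isProbabilityMeasure : IsProbabilityMeasure P
  /-- Local probabilities converge: `φ^b_{Λ_n,p,q}(A) → P(A)` for every local event `A`. -/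
  tendsto_isLocalEvent : ∀ A : Set (BondConfig (Site d)), IsLocalEvent A →
    Tendsto (fun n : ℕ => rcBoxLaw d b p q n A) atTop (𝓝 (P A))

namespace IsRandomClusterLimit

variable {b : RCBoundary} {p q : ℝ} {P P' : Measure (BondConfig (Site d))}

/-- Real-valued form of the defining limit: `φ^b_{Λ_n,p,q}(A) → P(A)` in `ℝ` for local `A`. [cite: Grimmett2006, Thm. (4.19)(a)] -/
theorem tendsto_real (hP : IsRandomClusterLimit d b p q P) {A : Set (BondConfig (Site d))} (hA : IsLocalEvent A) :
    Tendsto (fun n : ℕ => (rcBoxLaw d b p q n).real A) atTop (𝓝 (P.real A)) := by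
  haveI := hP.isProbabilityMeasure
  exact (ENNReal.tendsto_toReal (measure_ne_top P A)).comp (hP.tendsto_isLocalEvent A hA)
    |>.congr fun n => rfl

/-- The defining limit with the box measure written on the box: `φ^b_{Λ_n,p,q}(toLattice⁻¹ A) → P(A)`.
[cite: Grimmett2006, Thm. (4.19)(a)] -/
theorem tendsto_real_preimage (hP : IsRandomClusterLimit d b p q P) {A : Set (BondConfig (Site d))}
    (hA : IsLocalEvent A) :
    Tendsto (fun n : ℕ => (rcMeasure (finsetGraph (zdGraph d) (box d n)) p q (b.wiredSet (box d n))).real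
      (toLattice (box d n) ⁻¹' A)) atTop (𝓝 (P.real A)) :=
  (hP.tendsto_real hA).congr fun n => rcBoxLaw_real_apply b p q n (measurableSet_of_isLocalEvent_holds hA)

/-- **Uniqueness of `φ^b_{p,q}`**: two measures satisfying `IsRandomClusterLimit d b p q` coincide (both are limits of the
same box probabilities on local events, which generate). [cite: Grimmett2006, Thm. (4.19)(a)] -/
theorem unique (hP : IsRandomClusterLimit d b p q P) (hP' : IsRandomClusterLimit d b p q P') : P = P' := by
  haveI := hP.isProbabilityMeasure
  exact measure_unique_of_tendsto_isLocalEvent (fun n => rcBoxLaw d b p q n) hP.tendsto_isLocalEvent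
    hP'.tendsto_isLocalEvent

/-- A pair which is not a lattice edge is almost surely closed under every box law. [cite: Grimmett2006, §4.2 (Ω = {0,1}^{𝔼^d})] -/
theorem rcBoxLaw_setOf_mem_eq_zero (b : RCBoundary) {p q : ℝ} (hp : p ∈ Set.Icc (0 : ℝ) 1) (hq : 0 < q) (n : ℕ)
    {e : Sym2 (Site d)} (he : e ∉ (zdGraph d).edgeSet) : rcBoxLaw d b p q n {ω | e ∈ ω} = 0 := by
  rw [rcBoxLaw, rcLaw_apply p q _ _ (measurableSet_of_isLocalEvent_holds (isLocalEvent_setOf_mem e))]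
  set G := finsetGraph (zdGraph d) (box d n)
  haveI := isProbabilityMeasure_rcMeasure G hp hq (b.wiredSet (box d n))
  have hsub : toLattice (box d n) ⁻¹' {ω : BondConfig (Site d) | e ∈ ω} ⊆
      {ω : BondConfig ↥(box d n) | ¬ ω ⊆ G.edgeSet} := by
    intro ω hω hωE
    obtain ⟨e', he', rfl⟩ := (mem_toLattice_iff ω e).1 hω
    apply he
    have h1 := hωE he'
    induction e' using Sym2.ind with
    | h a c => exact (SimpleGraph.mem_edgeSet _).2 ((SimpleGraph.mem_edgeSet _).1 h1)
  have h := rcMeasure_real_mono_on_edgeSets G hp hq (b.wiredSet (box d n))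
    (A := {ω : BondConfig ↥(box d n) | ¬ ω ⊆ G.edgeSet}) (A' := ∅) (fun ω hωE hω => (hω hωE).elim)
  rw [measureReal_empty] at h
  have h0 : (rcMeasure G p q (b.wiredSet (box d n))).real {ω | ¬ ω ⊆ G.edgeSet} = 0 :=
    le_antisymm h measureReal_nonneg
  exact measure_mono_null hsub ((measureReal_eq_zero_iff (measure_ne_top _ _)).1 h0)

/-- **`φ^b_{p,q}` is carried by lattice configurations**: `P`-almost surely only nearest-neighbour bonds of `ℤ^d` are open
(`p ∈ [0,1]`, `q > 0`). [cite: Grimmett2006, §4.2 (Ω = {0,1}^{𝔼^d})] -/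
theorem ae_subset_edgeSet (hP : IsRandomClusterLimit d b p q P) (hp : p ∈ Set.Icc (0 : ℝ) 1) (hq : 0 < q) :
    ∀ᵐ ω ∂P, ω ⊆ (zdGraph d).edgeSet :=
  ae_subset_of_measure_setOf_mem_eq_zero P _ fun _ he =>
    measure_setOf_mem_eq_zero_of_tendsto hP.tendsto_isLocalEvent fun n => rcBoxLaw_setOf_mem_eq_zero b hp hq n he

/-- Inequalities between box probabilities of local events, uniform in the box, pass to `φ^b_{p,q}`:
if `c · φ^b_{Λ_n}(A) ≤ φ^b_{Λ_n}(B)` for all `n` then `c · P(A) ≤ P(B)`. [cite: Grimmett2006, Prop. (4.10)(a)] -/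
theorem mul_le_of_forall_rcBoxLaw (hP : IsRandomClusterLimit d b p q P) {c : ℝ≥0∞} (hc : c ≠ ⊤)
    {A B : Set (BondConfig (Site d))} (hA : IsLocalEvent A) (hB : IsLocalEvent B)
    (h : ∀ n, c * rcBoxLaw d b p q n A ≤ rcBoxLaw d b p q n B) : c * P A ≤ P B :=
  le_of_tendsto_isLocalEvent hP.tendsto_isLocalEvent hc hA hB h

end IsRandomClusterLimit

/-! ### The interface `IsFKGibbs` -/

/-- **Interface of the FK-continuity programme: an infinite-volume random-cluster measure on `ℤ^d` with parameters
`p, q` in the weak (sandwich) DLR sense.**  `P` is a probability measure on bond configurations of `ℤ^d` which is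
(i) carried by lattice configurations; (ii) invariant under every translation of `ℤ^d` (Grimmett 2006, Thm. (4.19)(b));
(iii) positively associated on increasing local events (Thm. (4.17)(c)); (iv)–(v) **sandwiched between the free and the
wired finite-volume measures given any local information outside**: for every finite region `Λ ⊆ ℤ^d`, every
increasing event `A` determined by the edges `E_Λ` (both endpoints in `Λ`), and every event `H` determined by a finite
set of pairs disjoint from `E_Λ`,
`φ⁰_{Λ,p,q}(A) · P(H) ≤ P(A ∩ H) ≤ φ¹_{Λ,p,q}(A) · P(H)`
(the conditional law on `E_Λ` given `𝒯_Λ` is a finite-volume measure `φ^ξ_{Λ,p,q}` with the boundary condition induced by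
the outside, Lemma (4.13), and `φ⁰_Λ ≤st φ^ξ_Λ ≤st φ¹_Λ`, Lemma (4.14)(b); here `φ¹_Λ` wires the inner vertex boundary
`∂Λ`); (vi) ergodic under every non-zero translation (Cor. (4.23)).  The limit measures `φ⁰_{p,q}`, `φ¹_{p,q}`
(`IsRandomClusterLimit`) satisfy this for `p ∈ [0,1]`, `q ≥ 1` — the discharge theorem and the existence of the limits are
the companion files of FO-06; any consumer is conditional on them until they land.  The DLR equation (4.30) itself
(true for `φ^b_{p,q}`, Thm. (4.34)(b), via Burton–Keane and Lemma (4.39)) and finite energy (Thm. (4.17)(b) — the sandwich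
for the one-edge region) are not fields. [cite: Grimmett2006, Lemma (4.13), Lemma (4.14)(b), Thm. (4.17)(c), Thm. (4.19)(b), Cor. (4.23), §4.4] -/
structure IsFKGibbs (d : ℕ) (p q : ℝ) (P : Measure (BondConfig (Site d))) : Prop where
  /-- `P` is a probability measure. -/
  isProbabilityMeasure : IsProbabilityMeasure P
  /-- `P`-a.s. only nearest-neighbour bonds of `ℤ^d` are open. -/
  ae_subset_edgeSet : ∀ᵐ ω ∂P, ω ⊆ (zdGraph d).edgeSet
  /-- Translation invariance: every shift `x ↦ x + v` of `ℤ^d` preserves `P`. -/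
  measurePreserving_shift : ∀ v : Site d,
    MeasurePreserving (BondConfig.relabel (sym2Equiv (Site.shift v))) P P
  /-- Positive association (FKG) on increasing local events. -/
  fkg : ∀ ⦃A B : Set (BondConfig (Site d))⦄, IsLocalEvent A → IsLocalEvent B → IsUpperSet A → IsUpperSet B →
    P.real A * P.real B ≤ P.real (A ∩ B)
  /-- Lower sandwich (domain Markov + comparison of boundary conditions): given local information `H` off `E_Λ`, an
  increasing `E_Λ`-event is at least as likely as under the FREE measure of `Λ`. -/
  free_mul_le : ∀ (Λ : Finset (Site d)) ⦃A H : Set (BondConfig (Site d))⦄ (T : Finset (Sym2 (Site d))),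
    IsUpperSet A → DeterminedBy A ↑(edgesIn (zdGraph d) Λ) →
    Disjoint (↑T : Set (Sym2 (Site d))) ↑(edgesIn (zdGraph d) Λ) → DeterminedBy H ↑T →
    (rcLaw d p q Λ ∅).real A * P.real H ≤ P.real (A ∩ H)
  /-- Upper sandwich: … and at most as likely as under the WIRED measure of `Λ` (inner vertex boundary `∂Λ` wired). -/
  le_wired_mul : ∀ (Λ : Finset (Site d)) ⦃A H : Set (BondConfig (Site d))⦄ (T : Finset (Sym2 (Site d))),
    IsUpperSet A → DeterminedBy A ↑(edgesIn (zdGraph d) Λ) →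
    Disjoint (↑T : Set (Sym2 (Site d))) ↑(edgesIn (zdGraph d) Λ) → DeterminedBy H ↑T →
    P.real (A ∩ H) ≤ (rcLaw d p q Λ (wiredBoundary (zdGraph d) Λ)).real A * P.real H
  /-- Ergodicity under every non-zero translation. -/
  ergodic_shift : ∀ v : Site d, v ≠ 0 → Ergodic (BondConfig.relabel (sym2Equiv (Site.shift v))) P

namespace IsFKGibbs

variable {p q : ℝ} {P : Measure (BondConfig (Site d))}

/-- Translation invariance in preimage form (the field `measure_preimage_shift` of the tree's
`IsInsertionTolerantErgodic`): `P(A + v) = P(A)`. [cite: Grimmett2006, Thm. (4.19)(b)] -/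
theorem measure_preimage_shift (hP : IsFKGibbs d p q P) (v : Site d) {S : Set (BondConfig (Site d))}
    (hS : MeasurableSet S) : P (BondConfig.relabel (sym2Equiv (Site.shift v)) ⁻¹' S) = P S :=
  (hP.measurePreserving_shift v).measure_preimage hS.nullMeasurableSet

/-- Unconditioned lower sandwich: an increasing `E_Λ`-local event is at least as likely under `P` as under the free
measure of `Λ` (`H = univ`; Grimmett 2006, (4.24)/(4.21) with `b = 0`). [cite: Grimmett2006, Thm. (4.19)(c) (4.21)] -/
theorem rcLaw_free_le (hP : IsFKGibbs d p q P) (Λ : Finset (Site d)) {A : Set (BondConfig (Site d))} (hA : IsUpperSet A)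
    (hAΛ : DeterminedBy A ↑(edgesIn (zdGraph d) Λ)) : (rcLaw d p q Λ ∅).real A ≤ P.real A := by
  haveI := hP.isProbabilityMeasure
  have h := hP.free_mul_le Λ (H := Set.univ) ∅ hA hAΛ (by simp)
    ((determinedBy_iff _ _).2 fun _ _ _ => Iff.rfl)
  simpa using h

/-- Unconditioned upper sandwich: an increasing `E_Λ`-local event is at most as likely under `P` as under the wired
measure of `Λ` (Grimmett 2006, (4.21) with `b = 1`). [cite: Grimmett2006, Thm. (4.19)(c) (4.21)] -/
theorem le_rcLaw_wired (hP : IsFKGibbs d p q P) (Λ : Finset (Site d)) {A : Set (BondConfig (Site d))} (hA : IsUpperSet A)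
    (hAΛ : DeterminedBy A ↑(edgesIn (zdGraph d) Λ)) :
    P.real A ≤ (rcLaw d p q Λ (wiredBoundary (zdGraph d) Λ)).real A := by
  haveI := hP.isProbabilityMeasure
  have h := hP.le_wired_mul Λ (H := Set.univ) ∅ hA hAΛ (by simp)
    ((determinedBy_iff _ _).2 fun _ _ _ => Iff.rfl)
  simpa using h

/-- **Events invariant under all translations are trivial** (the field `zero_one` of the tree's
`IsInsertionTolerantErgodic`), for `d ≥ 1`: ergodicity under the single translation by `e₀`. [cite: Grimmett2006, Cor. (4.23)] -/
theorem zero_one (hP : IsFKGibbs d p q P) (hd : 0 < d) {S : Set (BondConfig (Site d))} (hS : MeasurableSet S)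
    (hinv : ∀ v : Site d, BondConfig.relabel (sym2Equiv (Site.shift v)) ⁻¹' S = S) : P S = 0 ∨ P S = 1 := by
  haveI := hP.isProbabilityMeasure
  set v : Site d := Pi.single ⟨0, hd⟩ 1 with hv
  have hv0 : v ≠ 0 := by
    intro h
    have := congrFun h ⟨0, hd⟩
    simp [hv] at this
  exact (hP.ergodic_shift v hv0).toPreErgodic.prob_eq_zero_or_one hS (hinv v)

end IsFKGibbs

end Literature.Probability.LatticeModels

end
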